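import Summits.BirchSwinnertonDyer.BirchSwinnertonDyer.Theorems.SchneiderFreeAdditiveX3OrdinaryLineCharacter
import Summits.BirchSwinnertonDyer.BirchSwinnertonDyer.Theorems.SchneiderFreeAdditiveX3LineCharacterBaseChange
import HarnessLib

/-!
# The ordinary filtration WITH BOTH CHARACTERS (quotient `α^n`, line `ε·α^{-n}`): the `ℚ`-side datum and its
# two transports (quadratic twist; base change to a degree-one prime)

Cell `bsd-print-cf2`, seat `bsd-line-cf2-p1-w2` g6 (prover, width seat on crux stmt-BirchSwinnertonDyer-20368
`PrintCf2.SplitBadTwoRankOneOfFacts`; line `eisenstein_two_bdp_line` v9.5, skeleton 39f5ac8d37c86b7a). Brick F-B/F-D of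
the discharge road of the registered cite-level stub **`stub_ordinaryFiltrationAtTwo`** (the binder `hFilt` of p633758
`EisensteinTwo.finLoc_two_of_ordinaryFiltration`): ROUTE-FREE transport lemmas, general prime `p`. THEOREMS ONLY
(no definition, no named fact, no `sorry`); `--supports stmt-BirchSwinnertonDyer-20368`; closes nothing by itself;
BSD is not advanced by any of this; no summit statement is proved by this seat.

The datum `hFilt` asks, on `E[p^∞]`, for ONE subgroup `C` and a unit `α` such that every `σ` of Frobenius degree `n`
acts on `E[p^∞] ⧸ C` as any `N ≡ s₂·α^n (mod p^k)` in the GRADED sense (`p^k x ∈ C ⟹ res σ • x − N • x ∈ C`) and on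
`C[p^k]` as any `N ≡ s₁·ε(res σ)·α^{−n}` (`s₁, s₂ = ±1`). Cell bsd-schneider's files
`SchneiderFreeAdditiveX3OrdinaryLine{UnitRoot,Frobenius,Character}` (door-c6) prove exactly the UNTWISTED form of
both clauses for Greenberg's reduction line `C_v = (reductionDatum V p).plus` of a globally minimal GOOD ORDINARY `V/ℚ`
at the place `v ∋ p` of `ℚ` (Manin's relation + Weil pairing; `α = unitRoot V p`); this file repackages them in the
graded shape and carries them along the two transports the class needs.

* §1 `reductionDatum_smul_sub_zsmul_mem_of_isFrobPow` (the quotient clause GRADED modulo `C_v`, from door-c6's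
  level form `reductionDatum_smul_sub_mem_of_isFrobPow`) and **`ordinaryFiltration_rat`**: for `V/ℚ` globally
  minimal, `p ∤ Δ_V`, `p ∤ a_p`, `v ∋ p`: `∃ C α`, `α² = a_p α − p`, both clauses UNTWISTED (`s₁ = s₂ = 1`).
* §2 **`ordinaryFiltration_twist`** (any number field `K`, place `v`): along a SIGN-equivariant
  `e : V[p^∞] ≃+ W[p^∞]` (the twisting isomorphism of a quadratic twist) the untwisted datum on `C` becomes the
  SIGNED datum on `e(C)` (`s₁ = s₂ =` the sign of `e` at `res σ`).
* §3 **`ordinaryFiltration_baseChange_of_inertiaDeg_eq_one`** (`W/ℚ`, any number field `K`, `𝔭 ∣ v` with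
  `f(𝔭|v) = 1`): the signed datum passes from `(E[p^∞](ℚ̄), Γ_{ℚ_v})` to `(E_K[p^∞](K̄), Γ_{K_𝔭})` along
  `primaryBaseChangeEquiv ∘ (τ • ·)` (door-c4's `…LocalGaloisDegreeOne` plumbing: the two routes `Γ_{K_𝔭} → Γ_ℚ`
  are conjugate by `τ`; `Γ_{K_𝔭} → Γ_{ℚ_v}` preserves Frobenius degrees and `ε`).

References: [GreenbergLNM1716] §2 pp. 62–63 and p. 70 (after Prop. 2.4: `ψφ = χ` on the ordinary filtration);
[Greenberg1991] §2 (p. 214); [SerreInventiones1972] §1.11; [SilvermanAEC2009] III.8.1, V.2.3.1(b), X.5 Cor. 5.4;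
[SerreAbelianLadic1968] Ch. I §2.1; [JetchevSkinnerWan2017] §3.3 Prop. 3.3.4 Case 3(b).
-/

noncomputable section

open scoped Classical

namespace Summit.BirchSwinnertonDyer.BirchSwinnertonDyer.Theorems.PrintCf2.EisensteinTwo

open NumberField IsDedekindDomain Field WeierstrassCurve
  Literature.NumberTheory.EllipticCurves Literature.NumberTheory.EllipticCurves.GreenbergSelmer
  Literature.NumberTheory.GaloisRepresentations Literature.NumberTheory.Automorphic
  Summit.BirchSwinnertonDyer.Rank1Residual.X2.GreenbergVatsalReductionDatum
  Summit.BirchSwinnertonDyer.BirchSwinnertonDyer.Theorems.SchneiderFreeAdditiveX3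

set_option linter.dupNamespace false
set_option autoImplicit false

/-! ## §1. The `ℚ`-side datum: Greenberg's reduction line of a good ordinary `V/ℚ` with both characters -/

section Rat

variable (V : WeierstrassCurve ℚ) [V.IsGloballyMinimal] [V.IsElliptic] (p : ℕ) [hp : Fact p.Prime]
  {v : HeightOneSpectrum (𝓞 ℚ)}

/-- **The quotient `E[p^∞]/C_v` has Frobenius `α`, GRADED form.** `V/ℚ` globally minimal, `p ∤ Δ_V`, `p ∤ a_p`,
`v ∋ p`, `C_v = (reductionDatum V p).plus`, `α = unitRoot V p`: for `σ ∈ Γ_{ℚ_v}` of Frobenius degree `n`, every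
`x ∈ E[p^∞]` with `p^k x ∈ C_v` and every integer `N ≡ α^n (mod p^k)` satisfy `res σ • x − N • x ∈ C_v`. (Door-c6's
level form `reductionDatum_smul_sub_mem_of_isFrobPow` at a level `p^J` killing `x`, `J ≥ k`, plus
`(N − (α^n mod p^J)) • x ∈ p^k ℤ x ⊆ C_v`.) [cite: GreenbergLNM1716, §2 p. 70] -/
theorem reductionDatum_smul_sub_zsmul_mem_of_isFrobPow (hpv : ((p : ℕ) : 𝓞 ℚ) ∈ v.asIdeal)
    (hΔ : ¬ (p : ℤ) ∣ minimalDiscriminantInt V) (hord : ¬ (p : ℤ) ∣ V.frobeniusTrace p)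
    {σ : absoluteGaloisGroup (v.adicCompletion ℚ)} {n : ℕ} (hσ : IsFrobPow σ (n : ℤ)) (k : ℕ)
    (x : V.geomPrimaryTorsion p) (hx : p ^ k • x ∈ (reductionDatum V p hpv hΔ).plus) (N : ℤ)
    (hN : ((N : ℤ_[p]) - unitRoot V p ^ n) ∈ (Ideal.span {(p : ℤ_[p]) ^ k} : Ideal ℤ_[p])) :
    absGaloisRestrict ℚ (v.adicCompletion ℚ) σ • x - N • x ∈ (reductionDatum V p hpv hΔ).plus := by
  set C := (reductionDatum V p hpv hΔ).plus with hC
  obtain ⟨j, hj⟩ : ∃ j : ℕ, p ^ j • x = 0 := by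
    obtain ⟨j, hj⟩ := x.2
    exact ⟨j, Subtype.ext (by rw [AddSubgroupClass.coe_nsmul, hj]; rfl)⟩
  have hJ : p ^ (j + k) • x = 0 := by rw [pow_add, mul_comm, mul_smul, hj, smul_zero]
  have h1 := reductionDatum_smul_sub_mem_of_isFrobPow V p hpv hΔ hord hσ (j + k) x hJ
  set M : ℕ := (PadicInt.toZModPow (j + k) (unitRoot V p ^ n)).val with hM
  -- `M ≡ α^n (mod p^{j+k})`, hence `N ≡ M (mod p^k)`
  have hMmem : (((M : ℤ) : ℤ_[p])) - unitRoot V p ^ n ∈ (Ideal.span {(p : ℤ_[p]) ^ k} : Ideal ℤ_[p]) := by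
    have h' : (((M : ℤ) : ℤ_[p])) - unitRoot V p ^ n ∈ (Ideal.span {(p : ℤ_[p]) ^ (j + k)} : Ideal ℤ_[p]) := by
      rw [← PadicInt.ker_toZModPow, RingHom.mem_ker, map_sub, map_intCast, Int.cast_natCast, hM,
        ZMod.natCast_zmod_val, sub_self]
    exact Ideal.span_singleton_le_span_singleton.mpr (pow_dvd_pow _ (Nat.le_add_left k j)) h'
  have hNM : ((p : ℤ) ^ k) ∣ N - M := by
    rw [← PadicInt.pow_p_dvd_int_iff, ← Ideal.mem_span_singleton]
    have h := Ideal.sub_mem _ hN hMmem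
    have heq : ((N - M : ℤ) : ℤ_[p]) = ((N : ℤ_[p]) - unitRoot V p ^ n) - ((((M : ℤ) : ℤ_[p])) - unitRoot V p ^ n) := by
      push_cast; ring
    rw [heq]
    exact h
  obtain ⟨t, ht⟩ := hNM
  have h2 : (N - (M : ℤ)) • x ∈ C := by
    rw [ht, mul_comm, mul_smul, show ((p : ℤ) ^ k) = ((p ^ k : ℕ) : ℤ) by push_cast; rfl, natCast_zsmul]
    exact C.zsmul_mem hx t
  have h3 : absGaloisRestrict ℚ (v.adicCompletion ℚ) σ • x - N • x =
      (absGaloisRestrict ℚ (v.adicCompletion ℚ) σ • x - M • x) - (N - (M : ℤ)) • x := by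
    rw [sub_smul, natCast_zsmul]; abel
  rw [h3]
  exact C.sub_mem h1 h2

/-- **The `ℚ`-side ordinary filtration with both characters (UNTWISTED).** `V/ℚ` globally minimal, `p ∤ Δ_V`,
`p ∤ a_p(V)`, `v ∋ p`. There are `C ≤ E[p^∞](ℚ̄)` (Greenberg's reduction line `(reductionDatum V p).plus`) and a
unit `α ∈ ℤ_p` with `α² = a_p α − p` (`α = unitRoot V p`) such that every `σ ∈ Γ_{ℚ_v}` of Frobenius degree `n` acts
on `E[p^∞] ⧸ C` as any `N ≡ α^n (mod p^k)` (graded: `p^k x ∈ C ⟹ res σ • x − N • x ∈ C`) and on `C[p^k]` as any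
`N ≡ ε(res σ)·α^{−n} (mod p^k)`. (§1 + door-c6's `reductionDatum_lineCharacter`.)
[cite: GreenbergLNM1716, §2 p. 70 (after Prop. 2.4)] [cite: SilvermanAEC2009, Prop. III.8.1 and Thm. V.2.3.1(b)] -/
theorem ordinaryFiltration_rat (hpv : ((p : ℕ) : 𝓞 ℚ) ∈ v.asIdeal) (hΔ : ¬ (p : ℤ) ∣ minimalDiscriminantInt V)
    (hord : ¬ (p : ℤ) ∣ V.frobeniusTrace p) :
    ∃ (C : AddSubgroup (V.geomPrimaryTorsion p)) (α : ℤ_[p]ˣ),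
      (α : ℤ_[p]) ^ 2 = (V.frobeniusTrace p : ℤ_[p]) * (α : ℤ_[p]) - p ∧
      ∀ (σ : absoluteGaloisGroup (v.adicCompletion ℚ)) (n : ℕ), IsFrobPow σ (n : ℤ) →
        (∀ (k : ℕ) (x : V.geomPrimaryTorsion p), p ^ k • x ∈ C →
          ∀ N : ℤ, ((N : ℤ_[p]) - ((α ^ n : ℤ_[p]ˣ) : ℤ_[p])) ∈ (Ideal.span {(p : ℤ_[p]) ^ k} : Ideal ℤ_[p]) →
            absGaloisRestrict ℚ (v.adicCompletion ℚ) σ • x - N • x ∈ C) ∧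
        (∀ (k : ℕ) (c : V.geomPrimaryTorsion p), c ∈ C → p ^ k • c = 0 →
          ∀ N : ℤ, ((N : ℤ_[p]) -
              ((GaloisRep.cyclotomicCharacter ℚ p (absGaloisRestrict ℚ (v.adicCompletion ℚ) σ) * (α⁻¹) ^ n :
                ℤ_[p]ˣ) : ℤ_[p])) ∈ (Ideal.span {(p : ℤ_[p]) ^ k} : Ideal ℤ_[p]) →
            absGaloisRestrict ℚ (v.adicCompletion ℚ) σ • c = N • c) := by
  obtain ⟨a, α, -, hαv, hline⟩ := reductionDatum_lineCharacter V p hpv hΔ hord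
  obtain ⟨hz, -⟩ := unitRoot_spec_holds V p ⟨V.hasGoodReductionAtPrime_of_not_dvd p hΔ, hord⟩
  refine ⟨(reductionDatum V p hpv hΔ).plus, α, ?_, fun σ n hσ ↦ ⟨fun k x hx N hN ↦ ?_, hline σ n hσ⟩⟩
  · rw [hαv]; linear_combination hz
  · refine reductionDatum_smul_sub_zsmul_mem_of_isFrobPow V p hpv hΔ hord hσ k x hx N ?_
    rw [← hαv, ← Units.val_pow_eq_pow_val]
    exact hN

end Rat

/-! ## §2. Transport along a sign-equivariant isomorphism (quadratic twist) -/

section Twist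

variable {K : Type} [Field K] [NumberField K] {V W : WeierstrassCurve K} {p : ℕ} [hp : Fact p.Prime]
  {v : HeightOneSpectrum (𝓞 K)}

/-- **Quadratic-twist transport of the ordinary filtration WITH BOTH CHARACTERS.** `K` a number field, `v` a place,
`e : V[p^∞] ≃+ W[p^∞]` additive and SIGN-equivariant at every `σ ∈ Γ_K` (the twisting isomorphism of `W ≅ V ⊗ ψ`,
`ψ` quadratic); on `V[p^∞]` a subgroup `C` and a unit `α` with the UNTWISTED clauses (quotient `α^n` graded modulo
`C`, line `ε·α^{−n}` on `C[p^k]`). Then `e(C) ≤ W[p^∞]` satisfies the SIGNED clauses of `hFilt` with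
`s₁ = s₂ = ψ(res σ) = ±1` the sign of `e` at `res σ`. Pure Galois-module algebra.
[cite: SilvermanAEC2009, X.5 Cor. 5.4] [cite: GreenbergLNM1716, §2 pp. 69–70] -/
theorem ordinaryFiltration_twist (e : ↥(V.geomPrimaryTorsion p) ≃+ ↥(W.geomPrimaryTorsion p))
    (he : ∀ σ : absoluteGaloisGroup K, (∀ m, e (σ • m) = σ • e m) ∨ (∀ m, e (σ • m) = -(σ • e m)))
    (C : AddSubgroup (V.geomPrimaryTorsion p)) (α : ℤ_[p]ˣ)
    (hchar : ∀ (σ : absoluteGaloisGroup (v.adicCompletion K)) (n : ℕ), IsFrobPow σ (n : ℤ) →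
      (∀ (k : ℕ) (x : V.geomPrimaryTorsion p), p ^ k • x ∈ C →
        ∀ N : ℤ, ((N : ℤ_[p]) - ((α ^ n : ℤ_[p]ˣ) : ℤ_[p])) ∈ (Ideal.span {(p : ℤ_[p]) ^ k} : Ideal ℤ_[p]) →
          absGaloisRestrict K (v.adicCompletion K) σ • x - N • x ∈ C) ∧
      (∀ (k : ℕ) (c : V.geomPrimaryTorsion p), c ∈ C → p ^ k • c = 0 →
        ∀ N : ℤ, ((N : ℤ_[p]) -
            ((GaloisRep.cyclotomicCharacter K p (absGaloisRestrict K (v.adicCompletion K) σ) * (α⁻¹) ^ n :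
              ℤ_[p]ˣ) : ℤ_[p])) ∈ (Ideal.span {(p : ℤ_[p]) ^ k} : Ideal ℤ_[p]) →
          absGaloisRestrict K (v.adicCompletion K) σ • c = N • c)) :
    ∀ (σ : absoluteGaloisGroup (v.adicCompletion K)) (n : ℕ), IsFrobPow σ (n : ℤ) →
      ∃ s₁ s₂ : ℤ, (s₁ = 1 ∨ s₁ = -1) ∧ (s₂ = 1 ∨ s₂ = -1) ∧
        (∀ (k : ℕ) (x : W.geomPrimaryTorsion p), p ^ k • x ∈ C.map e.toAddMonoidHom →
          ∀ N : ℤ, ((N : ℤ_[p]) - s₂ * ((α ^ n : ℤ_[p]ˣ) : ℤ_[p])) ∈ (Ideal.span {(p : ℤ_[p]) ^ k} : Ideal ℤ_[p]) →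
            absGaloisRestrict K (v.adicCompletion K) σ • x - N • x ∈ C.map e.toAddMonoidHom) ∧
        (∀ (k : ℕ) (c : W.geomPrimaryTorsion p), c ∈ C.map e.toAddMonoidHom → p ^ k • c = 0 →
          ∀ N : ℤ, ((N : ℤ_[p]) - s₁ *
              ((GaloisRep.cyclotomicCharacter K p (absGaloisRestrict K (v.adicCompletion K) σ) * (α⁻¹) ^ n :
                ℤ_[p]ˣ) : ℤ_[p])) ∈ (Ideal.span {(p : ℤ_[p]) ^ k} : Ideal ℤ_[p]) →
            absGaloisRestrict K (v.adicCompletion K) σ • c = N • c) := by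
  set C' : AddSubgroup (W.geomPrimaryTorsion p) := C.map e.toAddMonoidHom with hC'
  have hmem' : ∀ c : V.geomPrimaryTorsion p, e c ∈ C' ↔ c ∈ C := fun c ↦ by
    rw [hC', AddSubgroup.mem_map]
    constructor
    · rintro ⟨c₀, hc₀, h⟩
      rw [AddEquiv.coe_toAddMonoidHom] at h
      rwa [← e.injective h]
    · exact fun h ↦ ⟨c, h, rfl⟩
  intro σ n hσn
  set g := absGaloisRestrict K (v.adicCompletion K) σ with hg
  obtain ⟨hquot, hline⟩ := hchar σ n hσn
  rcases he g with hpos | hneg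
  · refine ⟨1, 1, Or.inl rfl, Or.inl rfl, fun k x hx N hN ↦ ?_, fun k c hc hpc N hN ↦ ?_⟩
    · obtain ⟨x₀, rfl⟩ : ∃ x₀, e x₀ = x := ⟨e.symm x, e.apply_symm_apply x⟩
      have hx₀ : p ^ k • x₀ ∈ C := by rw [← hmem', map_nsmul]; exact hx
      rw [Int.cast_one, one_mul] at hN
      have h := hquot k x₀ hx₀ N hN
      rw [← hg] at h
      rw [← hpos x₀, ← map_zsmul, ← map_sub, hmem']
      exact h
    · obtain ⟨c₀, rfl⟩ : ∃ c₀, e c₀ = c := ⟨e.symm c, e.apply_symm_apply c⟩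
      have hc₀ : c₀ ∈ C := (hmem' c₀).1 hc
      have hpc₀ : p ^ k • c₀ = 0 := e.injective (by rw [map_nsmul, hpc, map_zero])
      rw [Int.cast_one, one_mul] at hN
      have h := hline k c₀ hc₀ hpc₀ N hN
      rw [← hg] at h
      rw [← hpos c₀, h, map_zsmul]
  · refine ⟨-1, -1, Or.inr rfl, Or.inr rfl, fun k x hx N hN ↦ ?_, fun k c hc hpc N hN ↦ ?_⟩
    · obtain ⟨x₀, rfl⟩ : ∃ x₀, e x₀ = x := ⟨e.symm x, e.apply_symm_apply x⟩
      have hx₀ : p ^ k • x₀ ∈ C := by rw [← hmem', map_nsmul]; exact hx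
      have hN' : (((-N : ℤ) : ℤ_[p]) - ((α ^ n : ℤ_[p]ˣ) : ℤ_[p])) ∈ (Ideal.span {(p : ℤ_[p]) ^ k} : Ideal ℤ_[p]) := by
        have : (((-N : ℤ) : ℤ_[p]) - ((α ^ n : ℤ_[p]ˣ) : ℤ_[p])) =
            -(((N : ℤ_[p]) - (-1 : ℤ) * ((α ^ n : ℤ_[p]ˣ) : ℤ_[p]))) := by push_cast; ring
        rw [this]
        exact Submodule.neg_mem _ hN
      have h := hquot k x₀ hx₀ (-N) hN'
      rw [← hg] at h
      have h1 : g • e x₀ = -(e (g • x₀)) := by rw [hneg x₀, neg_neg]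
      have key : g • e x₀ - N • e x₀ = -(e (g • x₀ - (-N) • x₀)) := by
        rw [h1, map_sub, map_zsmul, neg_zsmul]; abel
      rw [key, neg_mem_iff, hmem']
      exact h
    · obtain ⟨c₀, rfl⟩ : ∃ c₀, e c₀ = c := ⟨e.symm c, e.apply_symm_apply c⟩
      have hc₀ : c₀ ∈ C := (hmem' c₀).1 hc
      have hpc₀ : p ^ k • c₀ = 0 := e.injective (by rw [map_nsmul, hpc, map_zero])
      have hN' : (((-N : ℤ) : ℤ_[p]) -
          ((GaloisRep.cyclotomicCharacter K p g * (α⁻¹) ^ n : ℤ_[p]ˣ) : ℤ_[p])) ∈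
          (Ideal.span {(p : ℤ_[p]) ^ k} : Ideal ℤ_[p]) := by
        have : (((-N : ℤ) : ℤ_[p]) -
            ((GaloisRep.cyclotomicCharacter K p g * (α⁻¹) ^ n : ℤ_[p]ˣ) : ℤ_[p])) =
            -(((N : ℤ_[p]) - (-1 : ℤ) *
              ((GaloisRep.cyclotomicCharacter K p g * (α⁻¹) ^ n : ℤ_[p]ˣ) : ℤ_[p]))) := by
          push_cast; ring
        rw [this]
        exact Submodule.neg_mem _ hN
      have h := hline k c₀ hc₀ hpc₀ (-N) hN'
      rw [← hg] at h
      have hneg' : g • e c₀ = -(e (g • c₀)) := by rw [hneg c₀, neg_neg]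
      rw [hneg', h, map_zsmul, neg_zsmul, neg_neg]

end Twist

/-! ## §3. Transport from `(E[p^∞](ℚ̄), Γ_{ℚ_v})` to `(E_K[p^∞](K̄), Γ_{K_𝔭})` at a prime with `f(𝔭|v) = 1` -/

section BaseChange

variable (W : WeierstrassCurve ℚ) {p : ℕ} [hp : Fact p.Prime]
  (K : Type) [Field K] [NumberField K] (v : HeightOneSpectrum (𝓞 ℚ))
  (𝔭 : HeightOneSpectrum (𝓞 K)) [h𝔭v : 𝔭.asIdeal.LiesOver v.asIdeal]

/-- **Base-change transport of the ordinary filtration WITH BOTH CHARACTERS at a prime of residue degree one.**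
`W/ℚ`, `K` a number field, `𝔭 ∣ v` with `f(𝔭|v) = 1`. A subgroup `C ≤ E[p^∞](ℚ̄)` and a unit `α` carrying the
SIGNED clauses of `hFilt` for `Γ_{ℚ_v}` yield the subgroup `f(C) ≤ E_K[p^∞](K̄)`,
`f = primaryBaseChangeEquiv ∘ (τ • ·)` (`τ ∈ Γ_ℚ` conjugating the two routes `Γ_{K_𝔭} → Γ_ℚ`, door-c4's
`exists_absGaloisRestrict_adicCompletion_conj`), carrying the same clauses for `Γ_{K_𝔭}` with the same `α` and the
same signs: `Γ_{K_𝔭} → Γ_{ℚ_v}` preserves Frobenius degrees (`f = 1`) and the cyclotomic character.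
[cite: SerreAbelianLadic1968, Ch. I §2.1] [cite: JetchevSkinnerWan2017, §3.3 Prop. 3.3.4 Case 3(b) (arXiv:1512.06894 p. 13)] -/
theorem ordinaryFiltration_baseChange_of_inertiaDeg_eq_one (hf : 𝔭.asIdeal.inertiaDeg (𝓞 ℚ) = 1)
    (C : AddSubgroup (W.geomPrimaryTorsion p)) (α : ℤ_[p]ˣ)
    (hchar : ∀ (σ : absoluteGaloisGroup (v.adicCompletion ℚ)) (n : ℕ), IsFrobPow σ (n : ℤ) →
      ∃ s₁ s₂ : ℤ, (s₁ = 1 ∨ s₁ = -1) ∧ (s₂ = 1 ∨ s₂ = -1) ∧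
        (∀ (k : ℕ) (x : W.geomPrimaryTorsion p), p ^ k • x ∈ C →
          ∀ N : ℤ, ((N : ℤ_[p]) - s₂ * ((α ^ n : ℤ_[p]ˣ) : ℤ_[p])) ∈ (Ideal.span {(p : ℤ_[p]) ^ k} : Ideal ℤ_[p]) →
            absGaloisRestrict ℚ (v.adicCompletion ℚ) σ • x - N • x ∈ C) ∧
        (∀ (k : ℕ) (c : W.geomPrimaryTorsion p), c ∈ C → p ^ k • c = 0 →
          ∀ N : ℤ, ((N : ℤ_[p]) - s₁ *
              ((GaloisRep.cyclotomicCharacter ℚ p (absGaloisRestrict ℚ (v.adicCompletion ℚ) σ) * (α⁻¹) ^ n :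
                ℤ_[p]ˣ) : ℤ_[p])) ∈ (Ideal.span {(p : ℤ_[p]) ^ k} : Ideal ℤ_[p]) →
            absGaloisRestrict ℚ (v.adicCompletion ℚ) σ • c = N • c)) :
    ∃ C' : AddSubgroup ((W.baseChange K).geomPrimaryTorsion p),
      ∀ (σ : absoluteGaloisGroup (𝔭.adicCompletion K)) (n : ℕ), IsFrobPow σ (n : ℤ) →
        ∃ s₁ s₂ : ℤ, (s₁ = 1 ∨ s₁ = -1) ∧ (s₂ = 1 ∨ s₂ = -1) ∧
          (∀ (k : ℕ) (x : (W.baseChange K).geomPrimaryTorsion p), p ^ k • x ∈ C' →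
            ∀ N : ℤ, ((N : ℤ_[p]) - s₂ * ((α ^ n : ℤ_[p]ˣ) : ℤ_[p])) ∈
                (Ideal.span {(p : ℤ_[p]) ^ k} : Ideal ℤ_[p]) →
              absGaloisRestrict K (𝔭.adicCompletion K) σ • x - N • x ∈ C') ∧
          (∀ (k : ℕ) (c : (W.baseChange K).geomPrimaryTorsion p), c ∈ C' → p ^ k • c = 0 →
            ∀ N : ℤ, ((N : ℤ_[p]) - s₁ *
                ((GaloisRep.cyclotomicCharacter K p (absGaloisRestrict K (𝔭.adicCompletion K) σ) * (α⁻¹) ^ n :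
                  ℤ_[p]ˣ) : ℤ_[p])) ∈ (Ideal.span {(p : ℤ_[p]) ^ k} : Ideal ℤ_[p]) →
              absGaloisRestrict K (𝔭.adicCompletion K) σ • c = N • c) := by
  letI := (adicCompletionOfLiesOver ℚ K v 𝔭).toAlgebra
  obtain ⟨τ, hτc⟩ := exists_absGaloisRestrict_adicCompletion_conj K v 𝔭
  set Φ := absGaloisRestrict (v.adicCompletion ℚ) (𝔭.adicCompletion K) with hΦ
  set e := primaryBaseChangeEquiv K W p with he_def
  set g : W.geomPrimaryTorsion p ≃+ W.geomPrimaryTorsion p :=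
    DistribMulAction.toAddEquiv (W.geomPrimaryTorsion p) τ with hg
  set f : W.geomPrimaryTorsion p ≃+ (W.baseChange K).geomPrimaryTorsion p := g.trans e with hf_def
  have hf_apply : ∀ m, f m = e (τ • m) := fun m => rfl
  have hkey : ∀ (σ : absoluteGaloisGroup (𝔭.adicCompletion K)) (m : W.geomPrimaryTorsion p),
      absGaloisRestrict K (𝔭.adicCompletion K) σ • f m =
        f (absGaloisRestrict ℚ (v.adicCompletion ℚ) (Φ σ) • m) := fun σ m => by
    rw [hf_apply, hf_apply, he_def]
    exact absGaloisRestrict_smul_primaryBaseChangeEquiv_smul W K v 𝔭 hτc σ m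
  have hmem' : ∀ c : W.geomPrimaryTorsion p, f c ∈ C.map f.toAddMonoidHom ↔ c ∈ C := fun c ↦ by
    rw [AddSubgroup.mem_map]
    constructor
    · rintro ⟨c₀, hc₀, h⟩
      rw [AddEquiv.coe_toAddMonoidHom] at h
      rwa [← f.injective h]
    · exact fun h ↦ ⟨c, h, rfl⟩
  refine ⟨C.map f.toAddMonoidHom, fun σ n hσ ↦ ?_⟩
  have hΦσ : IsFrobPow (Φ σ) (n : ℤ) :=
    isFrobPow_absGaloisRestrict_adicCompletion_of_inertiaDeg_eq_one K v 𝔭 hf hσ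
  obtain ⟨s₁, s₂, hs₁, hs₂, hquot, hline⟩ := hchar (Φ σ) n hΦσ
  refine ⟨s₁, s₂, hs₁, hs₂, fun k x hx N hN ↦ ?_, fun k c hc hpk N hN ↦ ?_⟩
  · obtain ⟨x₀, rfl⟩ : ∃ x₀, f x₀ = x := ⟨f.symm x, f.apply_symm_apply x⟩
    have hx₀ : p ^ k • x₀ ∈ C := by rw [← hmem', map_nsmul]; exact hx
    rw [hkey σ x₀, ← map_zsmul, ← map_sub, hmem']
    exact hquot k x₀ hx₀ N hN
  · obtain ⟨c₀, rfl⟩ : ∃ c₀, f c₀ = c := ⟨f.symm c, f.apply_symm_apply c⟩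
    have hc₀ : c₀ ∈ C := (hmem' c₀).1 hc
    have hpk₀ : p ^ k • c₀ = 0 := f.injective (by rw [map_nsmul, hpk, map_zero])
    rw [cyclotomicCharacter_adicCompletion_eq_of_conj K v 𝔭 p hτc σ] at hN
    rw [hkey σ c₀, hline k c₀ hc₀ hpk₀ N hN, map_zsmul]

end BaseChange

end Summit.BirchSwinnertonDyer.BirchSwinnertonDyer.Theorems.PrintCf2.EisensteinTwo

end
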